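import Summits.ABC.IUTFork.Repair.CandMochizuki41Scaled
import Summits.ABC.IUTFork.Repair.CandMochizuki5
import Summits.ABC.IUTFork.Repair.CandMochizuki31
import Summits.ABC.IUTFork.Repair.CandInternal41
import Summits.ABC.IUTFork.Repair.CandLana1
import Summits.ABC.IUTFork.Repair.CandExplicit2
import Summits.ABC.IUTFork.Repair.CandDupuyHilado1
import HarnessLib

/-!
# IUT REPAIR branch (rung LADDER-ABC:A2.RP) — the «E7» COLUMN: label-sensitive candidate rows evaluated at the honestly scaled natural bed P♮ˢ(e)

Proof-only profile file (D-0012; NO definition, NO `Prop` fact) of the abc-iut cell's REPAIR branch (seat abc-iut-rp-m4 gen 3; pattern of the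
«2P» column `Repair/TwoPlaceProfile`). TAKES NO SIDE between Mochizuki, Scholze–Stix, Joshi, Dupuy–Hilado, LANA or anyone; every candidate below is a
HYPOTHESIS of the branch's table (`HOME/plan/repair/CANDIDATES.tsv`), evaluated here in theorem position at ONE model, never asserted; typed ≠ proved;
model data ≠ intended objects.

THE BED. E7 = P♮ˢ(e) (`Cor312NaturalScaledSetting` p446995 / `…Thm311` p447264 / `…Witness` p447544): abc-iut-w5-d230's P♮ with LABEL-DEPENDENT
Θ-regions `posK = [0, 2^{−e(j)}]` inside ONE shell of log-volume `0` at every label (print-pinned normalisation, [IUTchIII] Prop. 3.9 (i)–(ii)),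
moved onto `negK` by the genuine (Ind2) sign, hull the valuation ball `ballR (e j)`; for EVERY profile `e`: typed Thm. 3.11 ✓, pins ✓, `S` ✓,
Statement STRICT, `|log(q)| > 0`, Step (x) `LogvolInvariant` ✓. It is the first bed of record that is at once region-MOVING, Θ-side `j²`-HONEST
(profile `eθ`: own Θ-volumes `−1, −4`) and print-normalised — so the rows that compare volumes ACROSS labels or Θ-against-q get a new cell here.

RESULTS (ns `Summit.ABC.IUTFork.Repair.ScaledProfile`; ✓ = holds, ✗ = fails; all for EVERY `e` unless marked):
* `sc_thetaPilotOwnVol` — the Θ-pilot's own global volume EQUALS `−|log(q)|` (S through an isometry: BAR-V packetwise), whence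
  ✗ RP-M01a `CandMochizuki1.H` ((LVEx) strict left clause `own < −|log(q)|`), ✗ RP-M01b `H'` ((ΘInd) = ¬PilotKummerCompat), ✗ RP-M01c `H''`
  ((C13)/(C14) `own = avgJsq·(−|log(q)|)`), ✗ RP-M31 `CandMochizuki31.H N` for EVERY `N` (Θ-image volume `= N·j²·` q-volume fails at `j = 2`),
  ✓ RP-I4d `CandInternal41.HDegreeOrbit` AND its Statement-supplying strengthening `HDegreeOrbitGe` with the orbit parameter `c = 1`;
* ✓ RP-M45 `CandMochizuki5.H` ((MlLV) strict total hull inflation: `own = −|log(Θ)| − 1 < −|log(Θ)|`);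
* ✓ RP-L01 `CandLana1.H` (LANA (9-1): the global possible image «q-half everywhere» has volume `= −|log(q)|`);
* ✓ RP-X02 `CandExplicit2.H` (C_Θ-form) and ✓ RP-H01 `CandDupuyHilado1.H` (= the typed Statement);
* RP-M51 `CandMochizuki41.H` ✓ iff `e 1 ≠ e 2` (`CandMochizuki41Scaled.H_sc_iff`), ✓ at `eθ`;
* `scaled_column` — the column at the Θ-honest profile `eθ`, with S ✓, Licence ✓, Statement ✓ alongside.
READING (neutral; census ≠ verdict): on the honest region-moving bed the GLOBAL-volume rows of `≤`/`=` type hold (Statement, X02, H01, L01, I4d with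
`c = 1`, M45), while every row pinning the Θ-volume to a NON-TRIVIAL multiple of the q-volume (M01a strict, M01c `avgJsq`, M31 `N·j²`) fails —
because S realised through an isometric indeterminacy forces own Θ-volume = q-volume packet by packet, honest Θ-side `j²` notwithstanding
(the `j²` then shows up on the q-side: q-volumes `−1, −4` at `eθ`, the label-independence clause of the ∀-countermodel being the one given up,
`NaturalScaledWitness.scaled_not_scaled_and_labelFree`). Nothing here grades any row's faithfulness (T-d). Standard axioms only.
-/

noncomputable section

open Set

namespace Summit.ABC.IUTFork.Repair.ScaledProfile

open Thm311 Cor312 Cor312Vol Literature.IUT.LogThetaLattice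
open Cor312.Checks Cor312.IdentifiedNonVacuity Cor312.ScaledCopies Cor312Vol.NaiveWitness Cor312Vol.PinnedWitness Cor312Vol.NaturalWitness
  Cor312Vol.NaturalScaledWitness

variable (e : toyIndex.Label → ℕ)
  (ρ : (∀ v : toyIndex.V, v ∈ toyIndex.Vbad → Set (signShells.StarPacket v)) → ∀ (j : toyIndex.Label) (vQ : toyIndex.VQ), Set (signShells.Packet j vQ))
  (qK : ∀ v : toyIndex.V, v ∈ toyIndex.Vbad → Set (signShells.StarPacket v))

/-! ## 1. The Θ-pilot's own global volume equals `−|log(q)|` (S through an isometry) -/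

/-- **The Θ-pilot's OWN procession-normalised global volume at P♮ˢ(e) is `PN(j ↦ −e(j) − 1) = −|log(q)|`** (rp-m1's `thetaPilotOwnVol`; the
q-region is the sign-translate of the Θ-region and the volume is sign-invariant). [folklore] -/
theorem sc_thetaPilotOwnVol (m : ℤ) : CandMochizuki1.thetaPilotOwnVol (scFull e).toLatticeSituation (scSetting e) m = (scSetting e).negLogQ := by
  unfold CandMochizuki1.thetaPilotOwnVol
  rw [sc_negLogQ]
  congr 1
  funext i
  rw [finsum_unique]
  exact sc_logvol_thetaRegion e m i _

/-- The same number in abc-iut-rp-d3's notation: `CandInternal41.negLogThetaAt m = −|log(q)|`. [folklore] -/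
theorem sc_negLogThetaAt (m : ℤ) : CandInternal41.negLogThetaAt (scFull e).toLatticeSituation (scSetting e) m = (scSetting e).negLogQ :=
  sc_thetaPilotOwnVol e m

/-! ## 2. The Θ-against-q volume rows -/

/-- ✗ **RP-M01a** (`CandMochizuki1.H`: «own Θ-volume STRICTLY below `−|log(q)|`, and the Statement»): the strict clause fails — the two are EQUAL.
[folklore] -/
theorem M01a_fails : ¬ CandMochizuki1.H (scFull e).toLatticeSituation (scSetting e) ρ qK := fun h => by
  have h0 := h.1 0
  rw [sc_thetaPilotOwnVol] at h0
  exact lt_irrefl _ h0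

/-- ✗ **RP-M01b** (`CandMochizuki1.H'` = (ΘInd), «no (Ind1),(Ind2)-automorphism carries a Θ-Kummer image onto the q-datum») at the bed's own
q-datum: `flipFamily` does exactly that (`sc_pilotKummerCompat`). [folklore] -/
theorem M01b_fails : ¬ CandMochizuki1.H' (scFull e).toLatticeSituation (scSetting e) ρ (qDatumK e) := fun h =>
  h ⟨flipFamily, flipFamily_mem_indGroup_sc e, 0, fun _ _ => rfl⟩

/-- ✗ **RP-M01c** (`CandMochizuki1.H''` = (C13)/(C14) «own Θ-degree = avgJsq · (−|log(q)|)»): with own `= −|log(q)| < 0` this would need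
`avgJsq = 1`, but `avgJsq − 1 ≥ 3/2`. [folklore] -/
theorem M01c_fails : ¬ CandMochizuki1.H'' (scFull e).toLatticeSituation (scSetting e) ρ qK := fun h => by
  have h0 := h 0
  rw [sc_thetaPilotOwnVol] at h0
  have hq : (scSetting e).negLogQ < 0 := sc_absLogQPos e
  have ha := CandMochizuki1.three_halves_le_avgJsq_sub_one toyIndex
  nlinarith

/-- ✗ **RP-M31** (`CandMochizuki31.H N`: «the pinned Θ-image at label `j` has volume `N·j²` times the q-volume») for EVERY `N`: at the label `2`
the Θ-image `posK` and the q-image `negK` have the SAME volume `−e(2) − 1 ≠ 0`, so `4N = 1` would be needed. [folklore] -/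
theorem M31_fails (N : ℕ) : ¬ CandMochizuki31.H (scFull e).toLatticeSituation (scSetting e) segRegion (qDatumK e) N := fun h => by
  have h1 := h ⟨1, by decide⟩ ()
  rw [show ((scFull e).toLatticeSituation.D (scSetting e).n).Ψ = fun v _ => PsiK e v from rfl,
    segRegion_PsiK e (Setting.labelSucc_ne_zero _), sc_qLocal] at h1
  have hv : ((scFull e).toLatticeSituation.D (scSetting e).n).logvol _ () (posK e (Setting.labelSucc ⟨1, by decide⟩) ()) =
      -(e (Setting.labelSucc ⟨1, by decide⟩) : ℝ) - 1 := (scVol_values e _ ()).2.1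
  rw [hv] at h1
  norm_num at h1
  have hx : (0 : ℝ) < (e (Setting.labelSucc ⟨1, by decide⟩) : ℝ) + 1 := by positivity
  have hmul : ((4 : ℝ) * (N : ℝ) - 1) * ((e (Setting.labelSucc ⟨1, by decide⟩) : ℝ) + 1) = 0 := by linear_combination h1
  rcases mul_eq_zero.1 hmul with h4 | h0
  · have hN : 4 * N = 1 := by exact_mod_cast (show (4 : ℝ) * (N : ℝ) = 1 by linarith)
    omega
  · exact absurd h0 hx.ne'

/-- ✓ **RP-I4d** (`CandInternal41.HDegreeOrbit`: «−|log(q)| = c · deg(Θ-pilot at (n,m)) for ONE c > 0»): holds with `c = 1`. [folklore] -/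
theorem I4d_holds : CandInternal41.HDegreeOrbit (scFull e).toLatticeSituation (scSetting e) :=
  ⟨fun _ _ => Set.toFinite _, 1, one_pos, fun m => by rw [one_mul, sc_negLogThetaAt]⟩

/-- ✓ **RP-I4d′** (`CandInternal41.HDegreeOrbitGe`, the Statement-supplying strengthening `1 ≤ c`): holds with `c = 1`. [folklore] -/
theorem I4d'_holds : CandInternal41.HDegreeOrbitGe (scFull e).toLatticeSituation (scSetting e) :=
  ⟨fun _ _ => Set.toFinite _, 1, le_rfl, fun m => by rw [one_mul, sc_negLogThetaAt]⟩

/-! ## 3. The global-volume rows -/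

/-- ✓ **RP-M45** (`CandMochizuki5.H` = (MlLV) strict total hull inflation «`−|log(Θ)|` finite and STRICTLY above the own Θ-volume»): own
`= −|log(q)| = −|log(Θ)| − 1`. [folklore] -/
theorem M45_holds : CandMochizuki5.H (scFull e).toLatticeSituation (scSetting e) ρ qK :=
  ⟨(sc_statement_strict e).1.1, fun m => by rw [sc_thetaPilotOwnVol]; exact (sc_statement_strict e).2⟩

/-- ✓ **RP-L01** (`CandLana1.H` = LANA (9-1) «SOME global possible image has volume EQUAL to `−|log(q)|`»): the q-half `negK`, a possible image in
every packet, has exactly the q-volume. [cite: LANA2026Report, §9.2 (9-1) p. 46] -/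
theorem L01_holds : CandLana1.H (scFull e).toLatticeSituation (scSetting e) ρ qK := by
  refine ⟨⟨fun t => negK e (Setting.labelSucc t.1) t.2, fun t => ?_⟩, ?_⟩
  · rw [sc_possibleImages e (Setting.labelSucc_ne_zero t.1)]
    exact Set.mem_insert_of_mem _ rfl
  · rw [sc_negLogQ]
    congr 1
    funext i
    rw [finsum_unique]
    exact (scVol_values e _ _).2.2.1

/-- ✓ **RP-X02** (`CandExplicit2.H`, MFHMP's `C_Θ`-form of the Corollary). [folklore] -/
theorem X02_holds : CandExplicit2.H (scFull e).toLatticeSituation (scSetting e) :=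
  (CandExplicit2.H_iff_statement _ _ (sc_absLogQPos e)).2 (sc_statement_strict e).1

/-- ✓ **RP-H01** (`CandDupuyHilado1.H`, Dupuy–Hilado's Inequality 3.12 = the typed Statement). [folklore] -/
theorem H01_holds : CandDupuyHilado1.H (scFull e).toLatticeSituation (scSetting e) := (sc_statement_strict e).1

/-! ## 4. The column at the Θ-honest profile `eθ` -/

/-- **THE «E7» COLUMN at P♮ˢ(eθ)** (own Θ-volumes `−1, −4`; q-volumes `−1, −4`; hull `0, −3`; shell `0, 0`): S ✓ · Licence ✓ · Statement ✓ ·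
RP-M51 `CandMochizuki41.H` ✓ · RP-M45 ✓ · RP-L01 ✓ · RP-X02 ✓ · RP-H01 ✓ · RP-I4d ✓ (and I4d′ ✓, `c = 1`) · RP-M01a ✗ · RP-M01b ✗ · RP-M01c ✗ ·
RP-M31 ✗ for every `N`. [folklore] -/
theorem scaled_column :
    PilotKummerIndRelated (scFull eθ).toLatticeSituation (scSetting eθ) segRegion (qDatumK eθ) ∧ Thm311ToCor312.Licence (scSetting eθ) ∧
      (scSetting eθ).Statement ∧ CandMochizuki41.H (scFull eθ).toLatticeSituation (scSetting eθ) ∧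
      CandMochizuki5.H (scFull eθ).toLatticeSituation (scSetting eθ) segRegion (qDatumK eθ) ∧
      CandLana1.H (scFull eθ).toLatticeSituation (scSetting eθ) segRegion (qDatumK eθ) ∧
      CandExplicit2.H (scFull eθ).toLatticeSituation (scSetting eθ) ∧ CandDupuyHilado1.H (scFull eθ).toLatticeSituation (scSetting eθ) ∧
      CandInternal41.HDegreeOrbit (scFull eθ).toLatticeSituation (scSetting eθ) ∧ CandInternal41.HDegreeOrbitGe (scFull eθ).toLatticeSituation (scSetting eθ) ∧
      ¬ CandMochizuki1.H (scFull eθ).toLatticeSituation (scSetting eθ) segRegion (qDatumK eθ) ∧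
      ¬ CandMochizuki1.H' (scFull eθ).toLatticeSituation (scSetting eθ) segRegion (qDatumK eθ) ∧
      ¬ CandMochizuki1.H'' (scFull eθ).toLatticeSituation (scSetting eθ) segRegion (qDatumK eθ) ∧
      (∀ N : ℕ, ¬ CandMochizuki31.H (scFull eθ).toLatticeSituation (scSetting eθ) segRegion (qDatumK eθ) N) :=
  ⟨sc_pilotKummerIndRelated eθ, sc_licence eθ, (sc_statement_strict eθ).1, CandMochizuki41.H_scθ, M45_holds eθ _ _, L01_holds eθ _ _,
    X02_holds eθ, H01_holds eθ, I4d_holds eθ, I4d'_holds eθ, M01a_fails eθ _ _, M01b_fails eθ _, M01c_fails eθ _ _, fun N => M31_fails eθ N⟩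

end Summit.ABC.IUTFork.Repair.ScaledProfile

end
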